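import Mathlib
import Summits.ValiantsHypothesis.ValiantsHypothesis.Theorems.NewtonUnitEquationsNewtonTauWeakCornerRigidity

/-!
# `NewtonTauWeak` (stmt-ValiantsHypothesis-5904), sub-stub `fixedKCoincidence_t2_K3`: the RAY LEMMA of the
# corner model (two products at a common corner)

Support file (paper transcription of `Cruxes/NewtonTauWeak/Lines/binomial-normal-form-ltc.md` §3, the `t = 2`
ray lemma, over the corner-model objects of `…CornerDefs.lean`) for the crux
`Summit.ValiantsHypothesis.ValiantsHypothesis.Theses.NewtonUnitEquations.NewtonTauWeak`.  Setting: directions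
`E_e` of positive weight for a generic real weight, pairwise non-parallel rays, ONE separated product
`Π_e A_e(X^{E_e})` with constant terms `1` and degrees `≤ D`; its coefficient at `z` is the single-family fibre
sum `fibreSum E D 1 0 A A z`.  LETTER BOUND (`letter_bound`): a letter of a contributing word weighs the word
down by at least the order of its factor, with equality only for the pure order word.  RAY LEMMA (`ray_lemma`,
anchor `k3p_ray_lemma`): the `w`-initial exponent of `Π A − 1` (a nonzero point with nonzero fibre sum, all
lighter nonzero points cancelled) is the order point `o_{e₁}E_{e₁}` of the `w`-lightest active direction — in
particular it is ON a ray.  Used twice in the global count: two products sharing a corner with cancelling corner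
coefficients, and as the input of the deep lemma.
No definitions. [folklore]
-/

-- the namespace mandated for this Theorems file repeats the component `ValiantsHypothesis`
set_option linter.dupNamespace false

noncomputable section

open scoped BigOperators Polynomial
open Summit.ValiantsHypothesis.ValiantsHypothesis.Theorems.NewtonTauWeakCorner

namespace Summit.ValiantsHypothesis.ValiantsHypothesis.Theorems.NewtonTauWeakK3Paper

/-! ## Single-family fibre sums and the letter bound -/

/-- The single-family fibre sum `Σ_{push n = z} sepCoeff P n` is `fibreSum E D 1 0 P P z`. [folklore] -/
theorem fibreSum_one_zero {s D : ℕ} (E : Fin s → Fin 2 → ℤ) (P : Fin s → ℂ[X]) (z : Fin 2 → ℤ) :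
    fibreSum E D 1 0 P P z = ∑ n ∈ (box s D).filter (fun n => push E n = z), sepCoeff P n := by
  unfold fibreSum
  exact Finset.sum_congr rfl fun n _ => by ring

/-- A nonzero single-family fibre sum comes from a word with nonzero separated coefficient. [folklore] -/
theorem exists_word_of_fibreSum_ne_zero {s D : ℕ} (E : Fin s → Fin 2 → ℤ) (P : Fin s → ℂ[X]) {z : Fin 2 → ℤ}
    (h : fibreSum E D 1 0 P P z ≠ 0) : ∃ n ∈ box s D, push E n = z ∧ sepCoeff P n ≠ 0 := by
  classical
  rw [fibreSum_one_zero] at h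
  obtain ⟨n, hn, hne⟩ := Finset.exists_ne_zero_of_sum_ne_zero h
  rw [Finset.mem_filter] at hn
  exact ⟨n, hn.1, hn.2, hne⟩

/-- **Letter bound.** A letter `e` of a word `m` whose coefficient `[s^{m_e}]P_e` is nonzero weighs the
word down by at least the order of `P_e`: `o_e⟨w,E_e⟩ ≤ ⟨w, push m⟩`, with equality only for the pure word
`m = o_e[e]`. [folklore] -/
theorem letter_bound {s : ℕ} (E : Fin s → Fin 2 → ℤ) (w : Fin 2 → ℝ) (hw : ∀ e, 0 < wt w (E e))
    (P : Fin s → ℂ[X]) (o : Fin s → ℕ) (ho : ∀ e, Active (P e) → IsOrder (P e) (o e))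
    (m : Fin s → ℕ) (e : Fin s) (hme : m e ≠ 0) (hPe : (P e).coeff (m e) ≠ 0) :
    (o e : ℝ) * wt w (E e) ≤ wt w (push E m) ∧
      ((o e : ℝ) * wt w (E e) = wt w (push E m) → m = Pi.single e (o e)) := by
  classical
  have h1 : 1 ≤ m e := Nat.one_le_iff_ne_zero.mpr hme
  have hA : Active (P e) := active_of_coeff_ne_zero h1 hPe
  have hoe : o e ≤ m e := (ho e hA).le_of_coeff_ne_zero h1 hPe
  have hsplit : wt w (push E m) = (m e : ℝ) * wt w (E e) + ∑ x ∈ Finset.univ.erase e, (m x : ℝ) * wt w (E x) := by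
    rw [wt_push, ← Finset.add_sum_erase _ _ (Finset.mem_univ e)]
  have hrest : 0 ≤ ∑ x ∈ Finset.univ.erase e, (m x : ℝ) * wt w (E x) :=
    Finset.sum_nonneg fun x _ => mul_nonneg (by positivity) (hw x).le
  have hmo : (o e : ℝ) * wt w (E e) ≤ (m e : ℝ) * wt w (E e) :=
    mul_le_mul_of_nonneg_right (by exact_mod_cast hoe) (hw e).le
  refine ⟨by rw [hsplit]; linarith, fun heq => ?_⟩
  rw [hsplit] at heq
  have hrest0 : ∑ x ∈ Finset.univ.erase e, (m x : ℝ) * wt w (E x) = 0 := by linarith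
  have hme' : (m e : ℝ) * wt w (E e) = (o e : ℝ) * wt w (E e) := by linarith
  have hmeq : m e = o e := by
    have := mul_right_cancel₀ (hw e).ne' hme'
    exact_mod_cast this
  have hzero : ∀ x ∈ Finset.univ.erase e, (m x : ℝ) * wt w (E x) = 0 :=
    (Finset.sum_eq_zero_iff_of_nonneg fun x _ => mul_nonneg (by positivity) (hw x).le).mp hrest0
  funext x
  by_cases hx : x = e
  · subst hx; simp [hmeq]
  · have := hzero x (Finset.mem_erase.mpr ⟨hx, Finset.mem_univ x⟩)
    have hmx : (m x : ℝ) = 0 := by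
      rcases mul_eq_zero.mp this with h | h
      · exact h
      · exact absurd h (hw x).ne'
    simp [hx]
    exact_mod_cast hmx

/-- An order function by choice. [folklore] -/
theorem exists_order_fun {s : ℕ} (P : Fin s → ℂ[X]) :
    ∃ o : Fin s → ℕ, ∀ e, Active (P e) → IsOrder (P e) (o e) := by
  classical
  refine ⟨fun e => if h : Active (P e) then Classical.choose (exists_isOrder h) else 0, fun e h => ?_⟩
  simp only [dif_pos h]
  exact Classical.choose_spec (exists_isOrder h)

/-! ## The ray lemma (two products at a common corner) -/

/-- **Ray lemma.** For one separated product `Π_e A_e(X^{E_e})` (constant terms `1`), the `w`-initial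
exponent of `Π A − 1` — a nonzero point `v` with nonzero fibre sum below which every nonzero point is
cancelled — is the ORDER POINT `o_{e₁} E_{e₁}` of the `w`-lightest active direction. [folklore; the
`t = 2` ray lemma of `Cruxes/NewtonTauWeak/Lines/binomial-normal-form-ltc.md` §3] -/
theorem ray_lemma {s D : ℕ} (E : Fin s → Fin 2 → ℤ) (w : Fin 2 → ℝ)
    (hw : ∀ e, 0 < wt w (E e)) (hgen : Function.Injective (wt w))
    (hE : ∀ e e' : Fin s, ∀ k k' : ℕ, 1 ≤ k → (k : ℤ) • E e = (k' : ℤ) • E e' → e = e')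
    (A : Fin s → ℂ[X]) (hA0 : ∀ e, (A e).coeff 0 = 1) (hAD : ∀ e, (A e).natDegree ≤ D)
    (o : Fin s → ℕ) (ho : ∀ e, Active (A e) → IsOrder (A e) (o e))
    (v : Fin 2 → ℤ) (hv0 : v ≠ 0) (hv : fibreSum E D 1 0 A A v ≠ 0)
    (hcanc : ∀ z, z ≠ 0 → wt w z < wt w v → fibreSum E D 1 0 A A z = 0) :
    ∃ e₁ : Fin s, Active (A e₁) ∧ (∀ e, Active (A e) → (o e₁ : ℝ) * wt w (E e₁) ≤ (o e : ℝ) * wt w (E e)) ∧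
      v = (o e₁ : ℤ) • E e₁ := by
  classical
  -- a contributing word, hence an active direction
  obtain ⟨n, hnbox, hpush, hsep⟩ := exists_word_of_fibreSum_ne_zero E A hv
  have hn0 : n ≠ 0 := by rintro rfl; rw [push_zero] at hpush; exact hv0 hpush.symm
  obtain ⟨x, hx⟩ : ∃ x, n x ≠ 0 := by by_contra h; push Not at h; exact hn0 (funext h)
  set AA := Finset.univ.filter fun e => Active (A e) with hAA
  have hAAne : AA.Nonempty := ⟨x, Finset.mem_filter.mpr ⟨Finset.mem_univ x,
    active_of_coeff_ne_zero (Nat.one_le_iff_ne_zero.mpr hx) (sepCoeff_ne_zero_apply hsep x)⟩⟩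
  obtain ⟨e₁, he1, h1min⟩ := AA.exists_min_image (fun e => (o e : ℝ) * wt w (E e)) hAAne
  have hA1 : Active (A e₁) := (Finset.mem_filter.mp he1).2
  have h1min' : ∀ e, Active (A e) → (o e₁ : ℝ) * wt w (E e₁) ≤ (o e : ℝ) * wt w (E e) :=
    fun e hAe => h1min e (Finset.mem_filter.mpr ⟨Finset.mem_univ e, hAe⟩)
  have ho1 := ho e₁ hA1
  -- (F1): every nonzero contributing word weighs at least `o₁⟨w,E₁⟩`, equality only for the pure word
  have F1 : ∀ m : Fin s → ℕ, m ≠ 0 → sepCoeff A m ≠ 0 →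
      (o e₁ : ℝ) * wt w (E e₁) ≤ wt w (push E m) ∧
      ((o e₁ : ℝ) * wt w (E e₁) = wt w (push E m) → m = Pi.single e₁ (o e₁)) := by
    intro m hm0 hsm
    obtain ⟨y, hy⟩ : ∃ y, m y ≠ 0 := by by_contra h; push Not at h; exact hm0 (funext h)
    have hPy := sepCoeff_ne_zero_apply hsm y
    have hAy : Active (A y) := active_of_coeff_ne_zero (Nat.one_le_iff_ne_zero.mpr hy) hPy
    have hlb := letter_bound E w hw A o ho m y hy hPy
    have hmin := h1min' y hAy
    refine ⟨hmin.trans hlb.1, fun heq => ?_⟩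
    have heq' : (o y : ℝ) * wt w (E y) = wt w (push E m) := le_antisymm hlb.1 (by rw [← heq]; exact hmin)
    have hmy := hlb.2 heq'
    -- `y = e₁` by genericity and non-parallelism
    have hval : (o y : ℝ) * wt w (E y) = (o e₁ : ℝ) * wt w (E e₁) := by linarith
    have hy1 : y = e₁ := by
      have h' : wt w ((o y : ℤ) • E y) = wt w ((o e₁ : ℤ) • E e₁) := by
        rw [wt_zsmul, wt_zsmul]; push_cast; exact hval
      exact hE y e₁ (o y) (o e₁) (ho y hAy).1 (hgen h')
    subst hy1
    exact hmy
  -- the fibre sum at the order point is the order coefficient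
  have hr1 : fibreSum E D 1 0 A A ((o e₁ : ℤ) • E e₁) = (A e₁).coeff (o e₁) := by
    rw [fibreSum_pure E w hw hE 1 0 A A hA0 hA0 e₁ (o e₁) ho1.1 (ho1.le_natDegree.trans (hAD e₁))]
    · ring
    · intro m _ h2 hsm
      have hsm' : sepCoeff A m ≠ 0 := by rcases hsm with h | h <;> exact h
      have hm0 : m ≠ 0 := by
        rintro rfl
        simp at h2
      have hF := F1 m hm0 hsm'
      rw [wt_zsmul]; push_cast
      refine lt_of_le_of_ne hF.1 fun heq => ?_
      have := hF.2 heq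
      subst this
      -- a pure word has one letter
      have : (Finset.univ.filter fun x => (Pi.single e₁ (o e₁) : Fin s → ℕ) x ≠ 0).card ≤ 1 := by
        rw [Finset.card_le_one]
        intro a ha b hb
        rw [Finset.mem_filter] at ha hb
        have ha' : a = e₁ := by by_contra h; exact ha.2 (by simp [h])
        have hb' : b = e₁ := by by_contra h; exact hb.2 (by simp [h])
        rw [ha', hb']
      omega
  have hwt1 : wt w ((o e₁ : ℤ) • E e₁) = (o e₁ : ℝ) * wt w (E e₁) := by rw [wt_zsmul]; push_cast; ring
  have hr1ne : ((o e₁ : ℤ) • E e₁) ≠ 0 := by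
    intro h; have := congrArg (wt w) h; rw [hwt1, wt_zero] at this
    have : (0 : ℝ) < (o e₁ : ℝ) * wt w (E e₁) := mul_pos (by exact_mod_cast ho1.1) (hw e₁)
    linarith
  -- hence `wt v ≤ o₁ wt₁`
  have hle : wt w v ≤ (o e₁ : ℝ) * wt w (E e₁) := by
    by_contra hlt
    push Not at hlt
    have := hcanc _ hr1ne (by rw [hwt1]; exact hlt)
    rw [hr1] at this
    exact ho1.2.1 this
  -- and `wt v ≥ o₁ wt₁` from the contributing word
  have hF := F1 n hn0 hsep
  rw [hpush] at hF
  have heq : (o e₁ : ℝ) * wt w (E e₁) = wt w v := le_antisymm hF.1 hle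
  have hn := hF.2 heq
  refine ⟨e₁, hA1, h1min', ?_⟩
  rw [← hpush, hn, push_single]


/-- ANCHOR (registered helper stub): the ray lemma, see `ray_lemma`. [folklore] -/
theorem k3p_ray_lemma {s D : ℕ} (E : Fin s → Fin 2 → ℤ) (w : Fin 2 → ℝ) (hw : ∀ e, 0 < wt w (E e)) (hgen : Function.Injective (wt w)) (hE : ∀ e e' : Fin s, ∀ k k' : ℕ, 1 ≤ k → (k : ℤ) • E e = (k' : ℤ) • E e' → e = e') (A : Fin s → ℂ[X]) (hA0 : ∀ e, (A e).coeff 0 = 1) (hAD : ∀ e, (A e).natDegree ≤ D) (o : Fin s → ℕ) (ho : ∀ e, Active (A e) → IsOrder (A e) (o e)) (v : Fin 2 → ℤ) (hv0 : v ≠ 0) (hv : fibreSum E D 1 0 A A v ≠ 0) (hcanc : ∀ z, z ≠ 0 → wt w z < wt w v → fibreSum E D 1 0 A A z = 0) : ∃ e₁ : Fin s, Active (A e₁) ∧ (∀ e, Active (A e) → (o e₁ : ℝ) * wt w (E e₁) ≤ (o e : ℝ) * wt w (E e)) ∧ v = (o e₁ : ℤ) • E e₁ :=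
  ray_lemma E w hw hgen hE A hA0 hAD o ho v hv0 hv hcanc

end Summit.ValiantsHypothesis.ValiantsHypothesis.Theorems.NewtonTauWeakK3Paper

end
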